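import Literature.Topology.FourManifolds.LevelSlabStraightening
import Literature.Topology.FourManifolds.LevelSlide
import HarnessLib

/-!
# Straightening an embedded hypersurface near a regular slab: the version for level slides

Topic `Literature/Topology/FourManifolds`; brick E3c of the constructive road (P1′) to
`Literature.Topology.FourManifolds.Trisection.isConnectedSum_of_reducing_separating`
(`ReducibleTrisectionSplitting.lean`, § Status).  This is `LevelSlabStraightening.lean`
(brick D3-c) verbatim, with the unit-speed field `U_N` on the ambient manifold `N` replaced by
a **level slide** `U_N : LevelSlide n S a` (`LevelSlide.lean`): of `U_N` the straightening uses
only the flow `fl`, its smoothness, the group law and the clock, and for the ladder bodies the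
ambient flow is known explicitly (`LevelSlide.exists_ofAmbient`), which the later bricks need
in order to fill the straightened surface through the `1`-handles.  The field `U_Q` on the
source `Q` stays a `LevelUnitField` (`IsRegularLevel.exists_levelUnitField`).  The cut-offs,
the displacement `disp`/`prof` and the clock on `Q` are those of `LevelSlabStraightening.lean`
(namespace `SlabStraightening`); the family is `slideFun t u = U_N.fl (f (U_Q.fl u (-θ))) θ`,
`θ = disp t u`, and the conclusion is the same: an ambient isotopy `Ψ` of `N` with
`Ψ_t ∘ f = slideFun t`, `Ψ_1 (f u) = U_N.fl (f (U_Q.drop u)) (σ u - a)` on `|σ u - a| ≤ 2η`,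
`Ψ_t ∘ f = f` off `|σ - a| < 5η/2`, levels of `S` kept (`exists_ambientIsotopy_straighten`),
and the straightened slab piece is the product `{U_N.fl (f c) r | σ c = a, |r| ≤ 2η}`
(`image_slab_eq_product_of`, stated for any family of maps `φ` in place of `U_N.fl`).  Everything is **proved**; no named fact is introduced.

## References
* J. Milnor, *Morse theory* (1963), Thm. 3.1. [Milnor1963]
* M. W. Hirsch, *Differential Topology* (1976), Ch. 8 §1, Thm. 1.3; Ch. 4 §6. [HirschDT1976]
* J. M. Lee, *Introduction to Smooth Manifolds*, 2nd ed. (2012), Thm. 9.12. [LeeSmoothManifolds2013]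
-/

noncomputable section

open scoped Manifold ContDiff Topology
open Set Function Metric Filter

universe u

namespace Literature.Topology.FourManifolds

/-- Local notation: `𝔼 n` is the model Euclidean space `EuclideanSpace ℝ (Fin n)`. -/
local notation "𝔼 " n:arg => EuclideanSpace ℝ (Fin n)

namespace SlideStraightening

open SlabStraightening

section Straighten

variable {m n : ℕ} {Q : Type u} [TopologicalSpace Q] [T2Space Q] [CompactSpace Q]
  [ChartedSpace (𝔼 (m + 1)) Q] [IsManifold (𝓡 (m + 1)) ∞ Q]
  {N : Type u} [TopologicalSpace N]
  [ChartedSpace (𝔼 (n + 1)) N] [IsManifold (𝓡 (n + 1)) ∞ N]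
  {f : Q → N} {S : N → ℝ} {a : ℝ}

/-- **The straightening family** `toFun t u = U_N.fl (f (U_Q.fl u (-θ))) θ`, `θ = disp t u`.
[folklore] -/
def slideFun (U_Q : LevelUnitField m (S ∘ f) a) (U_N : LevelSlide n S a) (η t : ℝ) (u : Q) : N :=
  U_N.fl (f (U_Q.fl u (-disp f S a η t u))) (disp f S a η t u)

variable (U_Q : LevelUnitField m (S ∘ f) a) (U_N : LevelSlide n S a) {η : ℝ}

/-- **The isotopy starts at `f`**: `toFun 0 = f`. [folklore] -/
theorem slideFun_zero : slideFun U_Q U_N η 0 = f := by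
  funext u
  simp [slideFun, disp_zero, U_N.fl_zero]

/-- **`toFun t = f` off the slab** `|σ - a| < 5η/2`. [folklore] -/
theorem slideFun_of_le_abs (hη : 0 < η) (t : ℝ) {u : Q} (hu : 5 / 2 * η ≤ |S (f u) - a|) :
    slideFun U_Q U_N η t u = f u := by
  simp [slideFun, disp_of_le_abs hη t hu, U_N.fl_zero]

/-- **`toFun 1` is the product map on the slab**: `toFun 1 u = U_N.fl (f (U_Q.drop u)) (σ u - a)`
for `|σ u - a| ≤ 2η`. [folklore] -/
theorem slideFun_one (hη : 0 < η) {u : Q} (hu : |S (f u) - a| ≤ 2 * η) :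
    slideFun U_Q U_N η 1 u = U_N.fl (f (U_Q.drop u)) (S (f u) - a) := by
  simp only [slideFun, disp_one hη hu, LevelUnitField.drop, Function.comp_apply, neg_sub]

variable (hηQ : 3 * η < U_Q.δ) (hηN : 3 * η < U_N.δ)
include hηQ hηN in
/-- **Levels are kept**: `S (toFun t u) = σ u` for every `t` and `u`. [folklore] -/
theorem apply_slideFun (hη : 0 < η) (t : ℝ) (u : Q) : S (slideFun U_Q U_N η t u) = S (f u) := by
  rcases lt_or_ge |S (f u) - a| (3 * η) with hu | hu
  · have h1 := SlabStraightening.apply_fl_neg_disp U_Q hηQ hu t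
    have hθ := abs_lt.1 ((abs_sub_disp_le (f := f) (S := S) (a := a) (η := η) t u).trans_lt
      (hu.trans hηN))
    have hu' := abs_lt.1 (hu.trans hηN)
    have hy : S (f (U_Q.fl u (-disp f S a η t u))) ∈ Ioo (a - U_N.δ) (a + U_N.δ) := by
      rw [h1, mem_Ioo]; constructor <;> linarith [hθ.1, hθ.2]
    have hy' : S (f (U_Q.fl u (-disp f S a η t u))) + disp f S a η t u ∈
        Ioo (a - U_N.δ) (a + U_N.δ) := by
      rw [h1, mem_Ioo]; constructor <;> linarith [hu'.1, hu'.2]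
    unfold slideFun
    rw [U_N.apply_fl_eq_add' hy hy', h1]; ring
  · rw [slideFun_of_le_abs U_Q U_N hη t (by linarith)]

include hηQ hηN in
/-- **Each stage is injective.** If `toFun t u = toFun t u'` then `σ u = σ u'` (apply `S`), so
the displacements agree, and peeling off the two flows and `f` gives `u = u'`. [folklore] -/
theorem injective_slideFun (hη : 0 < η) (hf : Injective f) (t : ℝ) :
    Injective (slideFun U_Q U_N η t) := by
  intro u u' h
  have hσ : S (f u) = S (f u') := by
    rw [← apply_slideFun U_Q U_N hηQ hηN hη t u, ← apply_slideFun U_Q U_N hηQ hηN hη t u', h]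
  have hθ : disp f S a η t u = disp f S a η t u' := by unfold disp; rw [hσ]
  unfold slideFun at h
  rw [hθ] at h
  have h2 : f (U_Q.fl u (-disp f S a η t u')) = f (U_Q.fl u' (-disp f S a η t u')) := by
    have := congrArg (fun y => U_N.fl y (-disp f S a η t u')) h
    simpa only [← U_N.fl_add, add_neg_cancel, U_N.fl_zero] using this
  have h3 := hf h2
  have := congrArg (fun x => U_Q.fl x (disp f S a η t u')) h3
  simpa only [← U_Q.fl_add, neg_add_cancel, U_Q.fl_zero] using this

/-! ### §4 Smoothness, and each stage is an immersion -/

/-- The two-variable map `G (x, s) = U_N.fl (f (U_Q.fl x (-s))) s` behind the family: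
`toFun t u = G (u, θ t u)`. [folklore] -/
def slideG (p : Q × ℝ) : N := U_N.fl (f (U_Q.fl p.1 (-p.2))) p.2

/-- `toFun t = G ∘ (id, θ t)`. [folklore] -/
theorem slideFun_eq_slideG_comp (t : ℝ) :
    slideFun U_Q U_N η t = slideG U_Q U_N ∘ fun u => (u, disp f S a η t u) := rfl

/-- `G` is smooth. [folklore] -/
theorem contMDiff_slideG (hf : ContMDiff (𝓡 (m + 1)) (𝓡 (n + 1)) ∞ f) :
    ContMDiff ((𝓡 (m + 1)).prod 𝓘(ℝ, ℝ)) (𝓡 (n + 1)) ∞ (slideG U_Q U_N) := by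
  unfold slideG
  have h1 : ContMDiff ((𝓡 (m + 1)).prod 𝓘(ℝ, ℝ)) (𝓡 (m + 1)) ∞
      fun p : Q × ℝ => U_Q.fl p.1 (-p.2) :=
    U_Q.contMDiff_fl.comp (contMDiff_fst.prodMk (contDiff_neg.comp_contMDiff contMDiff_snd))
  exact U_N.contMDiff_fl.comp ((hf.comp h1).prodMk contMDiff_snd)

/-- **The family is smooth jointly in `(t, u)`.** [folklore] -/
theorem contMDiff_uncurry_slideFun (hf : ContMDiff (𝓡 (m + 1)) (𝓡 (n + 1)) ∞ f) :
    ContMDiff (𝓘(ℝ, ℝ).prod (𝓡 (m + 1))) (𝓡 (n + 1)) ∞ (uncurry (slideFun U_Q U_N η)) :=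
  (contMDiff_slideG U_Q U_N hf).comp (contMDiff_snd.prodMk (contMDiff_uncurry_disp U_Q.contMDiff_f))

/-- Each stage is smooth. [folklore] -/
theorem contMDiff_slideFun (hf : ContMDiff (𝓡 (m + 1)) (𝓡 (n + 1)) ∞ f) (t : ℝ) :
    ContMDiff (𝓡 (m + 1)) (𝓡 (n + 1)) ∞ (slideFun U_Q U_N η t) :=
  (contMDiff_uncurry_slideFun U_Q U_N hf).comp (contMDiff_const.prodMk contMDiff_id)

/-- The time-`s` map of a level slide has injective differential (it is undone by the
time-`(-s)` map). [cite: LeeSmoothManifolds2013, Thm. 9.12] -/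
private theorem injective_mfderiv_slide_apply (x : N) (s : ℝ) :
    Injective (mfderiv (𝓡 (n + 1)) (𝓡 (n + 1)) (fun y => U_N.fl y s) x) := by
  have hs : ∀ r, ContMDiff (𝓡 (n + 1)) (𝓡 (n + 1)) ∞ fun y => U_N.fl y r := fun r =>
    U_N.contMDiff_fl.comp (contMDiff_id.prodMk contMDiff_const)
  have h1 : MDifferentiableAt (𝓡 (n + 1)) (𝓡 (n + 1)) (fun y => U_N.fl y s) x :=
    (hs s).mdifferentiableAt (by simp)
  have h2 : MDifferentiableAt (𝓡 (n + 1)) (𝓡 (n + 1)) (fun y => U_N.fl y (-s)) (U_N.fl x s) :=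
    (hs (-s)).mdifferentiableAt (by simp)
  have hcomp := mfderiv_comp x h2 h1
  have hid : ((fun y => U_N.fl y (-s)) ∘ fun y => U_N.fl y s) = id := funext fun y => by
    show U_N.fl (U_N.fl y s) (-s) = y
    rw [← U_N.fl_add, add_neg_cancel, U_N.fl_zero]
  rw [hid, mfderiv_id] at hcomp
  intro v w hvw
  have := congrArg (mfderiv (𝓡 (n + 1)) (𝓡 (n + 1)) (fun y => U_N.fl y (-s)) (U_N.fl x s)) hvw
  rwa [← ContinuousLinearMap.comp_apply, ← ContinuousLinearMap.comp_apply, ← hcomp] at this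

/-- **For frozen `s`, `x ↦ G (x, s)` is an immersion**: a flow map of `Q`, then the immersion
`f`, then a flow map of `N`. [folklore] -/
theorem injective_mfderiv_slideG_fst (hf : ContMDiff (𝓡 (m + 1)) (𝓡 (n + 1)) ∞ f)
    (hfi : ∀ x, Injective (mfderiv (𝓡 (m + 1)) (𝓡 (n + 1)) f x)) (s : ℝ) (x : Q) :
    Injective (mfderiv (𝓡 (m + 1)) (𝓡 (n + 1)) (fun z => slideG U_Q U_N (z, s)) x) := by
  have h1 : MDifferentiableAt (𝓡 (m + 1)) (𝓡 (m + 1)) (fun z => U_Q.fl z (-s)) x :=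
    (U_Q.contMDiff_fl_apply (-s)).mdifferentiableAt (by simp)
  have h2 : MDifferentiableAt (𝓡 (m + 1)) (𝓡 (n + 1)) f (U_Q.fl x (-s)) :=
    hf.mdifferentiableAt (by simp)
  have h3 : MDifferentiableAt (𝓡 (n + 1)) (𝓡 (n + 1)) (fun y => U_N.fl y s) (f (U_Q.fl x (-s))) :=
    ((U_N.contMDiff_fl.comp (contMDiff_id.prodMk contMDiff_const))).mdifferentiableAt (by simp)
  have hcomp1 := mfderiv_comp x h2 h1
  have hcomp2 := mfderiv_comp x h3 (h2.comp x h1)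
  have : (fun z => slideG U_Q U_N (z, s)) = (fun y => U_N.fl y s) ∘ (f ∘ fun z => U_Q.fl z (-s)) := rfl
  rw [this, hcomp2, hcomp1]
  exact (injective_mfderiv_slide_apply U_N _ s).comp
    ((hfi _).comp (injective_mfderiv_fl_apply U_Q x (-s)))

include hηQ hηN in
/-- **Each stage `toFun t` is an immersion.**  With `toFun t u = G (u, θ u)`,
`d(toFun t) v = d₁G v + dθ(v) ∂₂G`.  If this vanishes, apply `dS`: since `S ∘ toFun t = σ`,
`dσ v = 0`; as `θ = g ∘ σ` also `dθ v = 0`, so `d₁G v = 0` and `v = 0` because `G (·, s)` is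
an immersion. [folklore] -/
theorem injective_mfderiv_slideFun (hη : 0 < η) (hf : ContMDiff (𝓡 (m + 1)) (𝓡 (n + 1)) ∞ f)
    (hfi : ∀ x, Injective (mfderiv (𝓡 (m + 1)) (𝓡 (n + 1)) f x)) (t : ℝ) (u : Q) :
    Injective (mfderiv (𝓡 (m + 1)) (𝓡 (n + 1)) (slideFun U_Q U_N η t) u) := by
  set θ := disp f S a η t u with hθdef
  have hGd : MDifferentiableAt ((𝓡 (m + 1)).prod 𝓘(ℝ, ℝ)) (𝓡 (n + 1)) (slideG U_Q U_N) (u, θ) :=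
    (contMDiff_slideG U_Q U_N hf).mdifferentiableAt (by simp)
  have hθd : MDifferentiableAt (𝓡 (m + 1)) 𝓘(ℝ, ℝ) (disp f S a η t) u :=
    (contMDiff_disp U_Q.contMDiff_f t).mdifferentiableAt (by simp)
  have hP : HasMFDerivAt (𝓡 (m + 1)) ((𝓡 (m + 1)).prod 𝓘(ℝ, ℝ)) (fun u => (u, disp f S a η t u)) u
      ((ContinuousLinearMap.id ℝ (TangentSpace (𝓡 (m + 1)) u)).prod
        (mfderiv (𝓡 (m + 1)) 𝓘(ℝ, ℝ) (disp f S a η t) u)) :=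
    (hasMFDerivAt_id u).prodMk hθd.hasMFDerivAt
  have hT : HasMFDerivAt (𝓡 (m + 1)) (𝓡 (n + 1)) (slideFun U_Q U_N η t) u
      ((mfderiv ((𝓡 (m + 1)).prod 𝓘(ℝ, ℝ)) (𝓡 (n + 1)) (slideG U_Q U_N) (u, θ)).comp
        ((ContinuousLinearMap.id ℝ (TangentSpace (𝓡 (m + 1)) u)).prod
          (mfderiv (𝓡 (m + 1)) 𝓘(ℝ, ℝ) (disp f S a η t) u))) := by
    rw [slideFun_eq_slideG_comp]
    exact HasMFDerivAt.comp u hGd.hasMFDerivAt hP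
  -- `S ∘ toFun t = σ`, so `dS ∘ d(toFun t) = dσ`
  have hSd : MDifferentiableAt (𝓡 (n + 1)) 𝓘(ℝ, ℝ) S (slideFun U_Q U_N η t u) :=
    U_N.contMDiff_f.mdifferentiableAt (by simp)
  have hσeq : S ∘ slideFun U_Q U_N η t = S ∘ f :=
    funext fun u => apply_slideFun U_Q U_N hηQ hηN hη t u
  have hchainσ : mfderiv (𝓡 (m + 1)) 𝓘(ℝ, ℝ) (S ∘ f) u =
      (mfderiv (𝓡 (n + 1)) 𝓘(ℝ, ℝ) S (slideFun U_Q U_N η t u)).comp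
        (mfderiv (𝓡 (m + 1)) (𝓡 (n + 1)) (slideFun U_Q U_N η t) u) := by
    rw [← hσeq]; exact mfderiv_comp u hSd hT.mdifferentiableAt
  -- `θ = g ∘ σ`, so `dθ = dg ∘ dσ`
  have hprofd : MDifferentiableAt 𝓘(ℝ, ℝ) 𝓘(ℝ, ℝ) (prof a η t) ((S ∘ f) u) :=
    (contDiff_prof t).contMDiff.mdifferentiableAt (by simp)
  have hσd : MDifferentiableAt (𝓡 (m + 1)) 𝓘(ℝ, ℝ) (S ∘ f) u :=
    U_Q.contMDiff_f.mdifferentiableAt (by simp)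
  have hchainθ : mfderiv (𝓡 (m + 1)) 𝓘(ℝ, ℝ) (disp f S a η t) u =
      (mfderiv 𝓘(ℝ, ℝ) 𝓘(ℝ, ℝ) (prof a η t) ((S ∘ f) u)).comp
        (mfderiv (𝓡 (m + 1)) 𝓘(ℝ, ℝ) (S ∘ f) u) := by
    rw [disp_eq_prof_comp]; exact mfderiv_comp u hprofd hσd
  refine (injective_iff_map_eq_zero _).2 fun v hv => ?_
  have hσv : mfderiv (𝓡 (m + 1)) 𝓘(ℝ, ℝ) (S ∘ f) u v = 0 := by
    rw [hchainσ]
    change mfderiv (𝓡 (n + 1)) 𝓘(ℝ, ℝ) S (slideFun U_Q U_N η t u)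
      (mfderiv (𝓡 (m + 1)) (𝓡 (n + 1)) (slideFun U_Q U_N η t) u v) = 0
    rw [hv, map_zero]
  have hθv : mfderiv (𝓡 (m + 1)) 𝓘(ℝ, ℝ) (disp f S a η t) u v = 0 := by
    rw [hchainθ]
    change mfderiv 𝓘(ℝ, ℝ) 𝓘(ℝ, ℝ) (prof a η t) ((S ∘ f) u)
      (mfderiv (𝓡 (m + 1)) 𝓘(ℝ, ℝ) (S ∘ f) u v) = 0
    rw [hσv, map_zero]
  rw [hT.mfderiv] at hv
  have hv2 : mfderiv ((𝓡 (m + 1)).prod 𝓘(ℝ, ℝ)) (𝓡 (n + 1)) (slideG U_Q U_N) (u, θ)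
      (v, mfderiv (𝓡 (m + 1)) 𝓘(ℝ, ℝ) (disp f S a η t) u v) = 0 := hv
  rw [mfderiv_prod_eq_add_apply hGd] at hv2
  dsimp only at hv2
  rw [hθv, map_zero, add_zero] at hv2
  exact (injective_iff_map_eq_zero _).1 (injective_mfderiv_slideG_fst U_Q U_N hf hfi θ u) v hv2

/-! ### §5 The stages are embeddings; the smooth isotopy; ambient straightening -/

variable [T2Space N] [CompactSpace N]

include hηQ hηN in
omit [CompactSpace N] in
/-- **Each stage is a smooth embedding** (injective immersion of the compact `Q`,
`isSmoothEmbedding_of_injective_of_injective_mfderiv`). [cite: HirschDT1976, Ch. 1 §3 Thm. 3.1] -/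
theorem isSmoothEmbedding_slideFun (hη : 0 < η)
    (hf : Manifold.IsSmoothEmbedding (𝓡 (m + 1)) (𝓡 (n + 1)) ∞ f) (t : ℝ) :
    Manifold.IsSmoothEmbedding (𝓡 (m + 1)) (𝓡 (n + 1)) ∞ (slideFun U_Q U_N η t) :=
  isSmoothEmbedding_of_injective_of_injective_mfderiv (contMDiff_slideFun U_Q U_N hf.contMDiff t)
    (by norm_cast) (injective_slideFun U_Q U_N hηQ hηN hη hf.isEmbedding.injective t)
    (injective_mfderiv_slideFun U_Q U_N hηQ hηN hη hf.contMDiff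
      (fun x => injective_mfderiv_of_isImmersionAt' (hf.isImmersion.isImmersionAt x)) t)

/-- **The straightening family is a smooth isotopy** from `f` to `toFun 1`. [folklore] -/
def smoothIsotopy (hηQ : 3 * η < U_Q.δ) (hηN : 3 * η < U_N.δ) (hη : 0 < η)
    (hf : Manifold.IsSmoothEmbedding (𝓡 (m + 1)) (𝓡 (n + 1)) ∞ f) :
    SmoothIsotopy (𝓡 (m + 1)) (𝓡 (n + 1)) f (slideFun U_Q U_N η 1) where
  toFun := slideFun U_Q U_N η
  contMDiff := contMDiff_uncurry_slideFun U_Q U_N hf.contMDiff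
  isSmoothEmbedding := isSmoothEmbedding_slideFun U_Q U_N hηQ hηN hη hf
  map_zero := slideFun_zero U_Q U_N
  map_one := rfl

include hηQ hηN in
/-- **Straightening an embedded closed manifold near a regular slab, by an ambient isotopy.**
Let `f : Q ↪ N` be a smooth embedding of a closed manifold into a closed manifold, `S : N → ℝ`
smooth, `U_Q`, `U_N` unit-speed fields for `σ = S ∘ f` on `Q` and for `S` on `N` across the
level `a`, and `0 < η` with `3η < U_Q.δ`, `3η < U_N.δ`.  Then there is an ambient isotopy `Ψ`
of `N` with, for `-1/2 < t < 3/2`: `Ψ_t ∘ f = toFun t` (the straightening family); in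
particular `Ψ_1 (f u) = U_N.fl (f (U_Q.drop u)) (σ u - a)` on the slab `|σ u - a| ≤ 2η`
(**`Ψ_1 ∘ f` is the product of the image level `f (σ⁻¹ a)` with the flow interval there**),
`Ψ_t (f u) = f u` off the slab `|σ u - a| < 5η/2`, and `S (Ψ_t (f u)) = σ u` throughout
(isotopy extension, `SmoothIsotopy.exists_ambientIsotopy_comp_eq_holds`).
[cite: HirschDT1976, Ch. 8 §1, Thm. 1.3; Milnor1963, Thm. 3.1] -/
theorem exists_ambientIsotopy_straighten (hη : 0 < η)
    (hf : Manifold.IsSmoothEmbedding (𝓡 (m + 1)) (𝓡 (n + 1)) ∞ f) :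
    ∃ Ψ : AmbientIsotopy (𝓡 (n + 1)) N,
      (∀ t ∈ Ioo (-1 / 2 : ℝ) (3 / 2), ∀ u, Ψ.toFun t (f u) = slideFun U_Q U_N η t u) ∧
      (∀ u, |S (f u) - a| ≤ 2 * η →
        Ψ.toFun 1 (f u) = U_N.fl (f (U_Q.drop u)) (S (f u) - a)) ∧
      (∀ t ∈ Ioo (-1 / 2 : ℝ) (3 / 2), ∀ u, 5 / 2 * η ≤ |S (f u) - a| →
        Ψ.toFun t (f u) = f u) ∧
      (∀ t ∈ Ioo (-1 / 2 : ℝ) (3 / 2), ∀ u, S (Ψ.toFun t (f u)) = S (f u)) := by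
  obtain ⟨Ψ, hΨ⟩ := (smoothIsotopy U_Q U_N hηQ hηN hη hf).exists_ambientIsotopy_comp_eq_holds
  have key : ∀ t ∈ Ioo (-1 / 2 : ℝ) (3 / 2), ∀ u, Ψ.toFun t (f u) = slideFun U_Q U_N η t u := by
    intro t ht u
    have h := hΨ t ht u
    have h0 : (smoothIsotopy U_Q U_N hηQ hηN hη hf).toFun 0 u = f u :=
      congrFun (slideFun_zero U_Q U_N) u
    rw [h0] at h
    exact h
  refine ⟨Ψ, key, fun u hu => ?_, fun t ht u hu => ?_, fun t ht u => ?_⟩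
  · rw [key 1 (by norm_num) u, slideFun_one U_Q U_N hη hu]
  · rw [key t ht u, slideFun_of_le_abs U_Q U_N hη t hu]
  · rw [key t ht u, apply_slideFun U_Q U_N hηQ hηN hη t u]

include hηQ in
omit [TopologicalSpace N] [T2Space N] [CompactSpace N] in
/-- **The straightened piece is a product** (for any family `φ` of maps of `N`, e.g. the flow
of a level slide or of a unit field).  If `Φ (f u) = φ (f (drop u)) (σ u - a)` on the slab
`|σ u - a| ≤ 2η`, then `(Φ ∘ f) {|σ - a| ≤ 2η} = {φ (f c) r | σ c = a, |r| ≤ 2η}`. [folklore] -/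
theorem image_slab_eq_product_of (hη : 0 < η) (φ : N → ℝ → N) {Φ : N → N}
    (hΦ : ∀ u, |S (f u) - a| ≤ 2 * η → Φ (f u) = φ (f (U_Q.drop u)) (S (f u) - a)) :
    (Φ ∘ f) '' {u | |S (f u) - a| ≤ 2 * η} =
      (fun p : Q × ℝ => φ (f p.1) p.2) '' (((S ∘ f) ⁻¹' {a}) ×ˢ Icc (-(2 * η)) (2 * η)) := by
  ext y
  simp only [mem_image, mem_setOf_eq, Function.comp_apply, mem_prod, mem_preimage,
    mem_singleton_iff, mem_Icc, Prod.exists]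
  constructor
  · rintro ⟨u, hu, rfl⟩
    have hband : u ∈ U_Q.band := by
      rw [LevelUnitField.mem_band_iff, mem_Ioo, Function.comp_apply]
      have := abs_le.1 hu
      constructor <;> linarith [this.1, this.2]
    refine ⟨U_Q.drop u, S (f u) - a, ⟨U_Q.apply_drop hband, ?_, ?_⟩, (hΦ u hu).symm⟩
    · linarith [(abs_le.1 hu).1]
    · linarith [(abs_le.1 hu).2]
  · rintro ⟨c, r, ⟨hc, hr1, hr2⟩, rfl⟩
    have hr : r ∈ Ioo (-U_Q.δ) U_Q.δ := ⟨by linarith, by linarith⟩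
    have hσ : (S ∘ f) (U_Q.fl c r) = a + r := U_Q.apply_fl_of_apply_eq hc hr
    simp only [Function.comp_apply] at hσ
    have habs : |S (f (U_Q.fl c r)) - a| ≤ 2 * η := by
      rw [hσ, add_sub_cancel_left, abs_le]; exact ⟨hr1, hr2⟩
    refine ⟨U_Q.fl c r, habs, ?_⟩
    rw [hΦ _ habs, U_Q.drop_fl_of_apply_eq hc hr, hσ, add_sub_cancel_left]

end Straighten

end SlideStraightening
end Literature.Topology.FourManifolds
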